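import Literature.MathematicalPhysics.QuantumLattice.XXZAntiferromagnetThermalSpontaneousOrder
import HarnessLib

/-!
# Néel order ⟹ spontaneous staggered magnetisation for the XXZ antiferromagnet on the ISING side
# (`Δ ≥ 1`) at `T > 0`, `d ≥ 3` — Koma–Tasaki 1993 Theorem 2.1 BY NAME (non-commuting order parameter)

T. Koma, H. Tasaki, *Symmetry breaking in Heisenberg antiferromagnets*, Commun. Math. Phys. **158** (1993)
191–214 [KomaTasaki1993], §1 and Theorem 2.1: Dyson–Lieb–Simon proved Néel long-range order at `T > 0`,
`d ≥ 3`, which — the order operator `O_Λ = Σ_x(-1)^xSᶻ_x` NOT commuting with the Hamiltonian — does not by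
itself give a spontaneous staggered magnetisation; Theorem 2.1 ("a strict extension of Griffiths' theorem or
Theorem 1.2 of Dyson, Lieb and Simon, which are proved assuming that the order operator and the Hamiltonian
commute") closes the gap: `m_s ≥ σ`.  This file applies it, with hypothesis i) removed
(`KomaTasakiGriffithsTheoremSubsequence.lean` §3), to the tree's Néel order
`xxzAF_thermal_neel` (`XXZAntiferromagnetThermalOrder.lean`: `d ≥ 3`, every spin, `J > 0`, `Δ ≥ 1`, `β ≥ β₀`,
staggered long-range order of `Sᶻ`; Björnberg–Ueltschi 2022 Thm 3.2 / DLS 1978).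

* §1 (generic graph, PROVED): the HALF TURN ABOUT THE `2`-AXIS `U = (⨂_x e^{-i(π/2)Sʸ})²` (square of the
  tree's explicit quarter turn `spinRotation n (0, π/2, 0)`: `Sᶻ ↦ Sˣ ↦ -Sᶻ`, `Sʸ` fixed): `Sˣ ↦ -Sˣ`,
  `Sʸ ↦ Sʸ`, `Sᶻ ↦ -Sᶻ`; it fixes every XXZ bond, hence `xxzHamiltonian n G J Δ` for ALL `J, Δ` (KT93 (2.3)),
  and flips `O_Λ = Σ_x(-1)^xSᶻ_x` (KT93 (2.5)).
* §2 (torus): **`XXZKT.isingAFZ2System d L n J Δ`** — the KT93 `ℤ₂` system with `o_x = (-1)^xSᶻ_x`; dictionary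
  (`moment β 1 = |Λ|⁻²Σ_{x,y}(-1)^x(-1)^y Re⟨Sᶻ_xSᶻ_y⟩_β`).
* §3 **`xxzAF_thermal_spontaneousNeelMagnetisation`**: `d ≥ 3`, `S = n/2 ≥ ½`, `J > 0`, `Δ ≥ 1`: there is
  `β₀ > 0` such that for every `β ≥ β₀` there is `σ > 0` with: for every staggered field `B > 0` and `ε > 0`,
  eventually on the even tori `(ℤ/(2k+2)ℤ)^d`, **`σ - ε ≤ |Λ|⁻¹ Re⟨O_Λ⟩_{β, H - B·O_Λ}`**,
  `H = xxzHamiltonian n (torusGraph d (2k+2)) J Δ`, `O_Λ = Σ_x(-1)^xSᶻ_x` — i.e. `m_s ≥ σ > 0` along every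
  convergent choice of the limits (1.5)–(1.6).  (At `Δ = 1` the sharper `√3 σ` is
  `heisenbergAF_thermal_spontaneousStaggeredMagnetisation`.)

Everything is PROVED; one definition with body (the instance) plus the explicit rotations; no named fact.
NOT a statement about the Hubbard model.

## References

* [KomaTasaki1993] T. Koma, H. Tasaki, Commun. Math. Phys. 158 (1993) 191–214, §1 (1.1)–(1.8), §2, Theorem 2.1.
* [DLS1978] F. J. Dyson, E. H. Lieb, B. Simon, J. Stat. Phys. 18 (1978) 335–383, §1–§2, Theorem 1.2.
* [BjornbergUeltschi2022] J. E. Björnberg, D. Ueltschi, J. Math. Phys. 63 (2022), Theorem 3.2.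
* [Tasaki2020] H. Tasaki, *Physics and Mathematics of Quantum Many-Body Systems*, Springer 2020, §2.1–2.4.
-/

noncomputable section

open Matrix Finset Filter Topology
open scoped ComplexOrder Matrix.Norms.L2Operator
open Literature.MathematicalPhysics.QuantumLattice Literature.MathematicalPhysics.QuantumLattice.SpinOperators
  Literature.MathematicalPhysics.QuantumLattice.KomaTasaki Literature.Probability.LatticeModels

namespace Literature.MathematicalPhysics.QuantumLattice

namespace XXZKT

/-! ### §1. The half turn about the `2`-axis -/

section Graph

variable {Λ : Type*} [Fintype Λ] [DecidableEq Λ] (n : ℕ)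

/-- Conjugation is multiplicative: `U(AB)Uᴴ = (UAUᴴ)(UBUᴴ)` when `UᴴU = 1`. [cite: Tasaki2020, §2.2 eq. (2.2.13)] -/
private theorem conj_mul_of_conjTranspose_mul {m : Type*} [Fintype m] [DecidableEq m] {U : Matrix m m ℂ}
    (hU : Uᴴ * U = 1) (A B : Matrix m m ℂ) : U * (A * B) * Uᴴ = (U * A * Uᴴ) * (U * B * Uᴴ) := by
  simp only [Matrix.mul_assoc]
  rw [← Matrix.mul_assoc Uᴴ U, hU, Matrix.one_mul]

/-- The global quarter turn about the `2`-axis, `⨂_x e^{-i(π/2)Sʸ}` (the tree's explicit `spinRotation n (0,π/2,0)`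
at every site: `Sᶻ ↦ Sˣ`, `Sˣ ↦ -Sᶻ`, `Sʸ ↦ Sʸ`). [cite: Tasaki2020, §2.1 eq. (2.1.13), §2.2 eq. (2.2.12)] -/
def quarterTurnY : Op Λ (n + 1) :=
  productOp (fun _ : Λ => spinRotation n (Pi.single 1 (Real.pi / 2)))

/-- **The half turn about the `2`-axis** `U = (quarter turn)²`. [cite: KomaTasaki1993, §2 (2.3), (2.5)]
[cite: Tasaki2020, §2.2 eq. (2.2.12)] -/
def halfTurnY : Op Λ (n + 1) := quarterTurnY (Λ := Λ) n * quarterTurnY n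

/-- `Q Qᴴ = 1`. [cite: Tasaki2020, §2.2 eq. (2.2.12)] -/
theorem quarterTurnY_mul_conjTranspose : quarterTurnY (Λ := Λ) n * (quarterTurnY n)ᴴ = 1 :=
  productOp_mul_conjTranspose fun _ => spinRotation_y_mul_conjTranspose n

/-- `Qᴴ Q = 1`. [cite: Tasaki2020, §2.2 eq. (2.2.12)] -/
theorem quarterTurnY_conjTranspose_mul : (quarterTurnY (Λ := Λ) n)ᴴ * quarterTurnY n = 1 :=
  productOp_conjTranspose_mul fun _ => spinRotation_y_conjTranspose_mul n

/-- `U Uᴴ = 1`. [cite: KomaTasaki1993, §2 (U_Λ unitary)] -/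
theorem halfTurnY_mul_conjTranspose : halfTurnY (Λ := Λ) n * (halfTurnY n)ᴴ = 1 := by
  rw [halfTurnY, conjTranspose_mul, Matrix.mul_assoc, ← Matrix.mul_assoc (quarterTurnY n) (quarterTurnY n)ᴴ,
    quarterTurnY_mul_conjTranspose, Matrix.one_mul, quarterTurnY_mul_conjTranspose]

/-- `Uᴴ U = 1`. [cite: KomaTasaki1993, §2 (U_Λ unitary)] -/
theorem halfTurnY_conjTranspose_mul : (halfTurnY (Λ := Λ) n)ᴴ * halfTurnY n = 1 := by
  rw [halfTurnY, conjTranspose_mul, Matrix.mul_assoc, ← Matrix.mul_assoc (quarterTurnY n)ᴴ (quarterTurnY n),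
    quarterTurnY_conjTranspose_mul, Matrix.one_mul, quarterTurnY_conjTranspose_mul]

/-- Conjugation by the half turn is the quarter-turn conjugation applied twice. [cite: Tasaki2020, §2.2 eq. (2.2.12)] -/
theorem halfTurnY_conj (A : Op Λ (n + 1)) :
    halfTurnY n * A * (halfTurnY n)ᴴ =
      quarterTurnY n * (quarterTurnY n * A * (quarterTurnY n)ᴴ) * (quarterTurnY (Λ := Λ) n)ᴴ := by
  rw [halfTurnY, conjTranspose_mul]
  simp only [Matrix.mul_assoc]

/-- `Q Sᶻ_x Qᴴ = Sˣ_x`. [cite: Tasaki2020, §2.1 eq. (2.1.13)] -/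
theorem quarterTurnY_conj_siteSpin_two (x : Λ) :
    quarterTurnY n * siteSpin n x 2 * (quarterTurnY n)ᴴ = (siteSpin n x 0 : Op Λ (n + 1)) := by
  show _ = onSite x (spinVec n 0)
  rw [quarterTurnY, productOp_conj_siteSpin (fun _ => spinRotation_y_mul_conjTranspose n), spinVec_two, spinVec_zero,
    spinRotation_y_conj_spinZ]

/-- `Q Sˣ_x Qᴴ = -Sᶻ_x`. [cite: Tasaki2020, §2.1 eq. (2.1.13)] -/
theorem quarterTurnY_conj_siteSpin_zero (x : Λ) :
    quarterTurnY n * siteSpin n x 0 * (quarterTurnY n)ᴴ = -(siteSpin n x 2 : Op Λ (n + 1)) := by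
  show _ = -onSite x (spinVec n 2)
  rw [quarterTurnY, productOp_conj_siteSpin (fun _ => spinRotation_y_mul_conjTranspose n), spinVec_zero, spinVec_two,
    spinRotation_y_conj_spinX, onSite_neg']

/-- `Q Sʸ_x Qᴴ = Sʸ_x`. [cite: Tasaki2020, §2.1 eq. (2.1.13)] -/
theorem quarterTurnY_conj_siteSpin_one (x : Λ) :
    quarterTurnY n * siteSpin n x 1 * (quarterTurnY n)ᴴ = (siteSpin n x 1 : Op Λ (n + 1)) := by
  show _ = onSite x (spinVec n 1)
  rw [quarterTurnY, productOp_conj_siteSpin (fun _ => spinRotation_y_mul_conjTranspose n), spinVec_one,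
    spinRotation_y_conj_spinY]

/-- `U Sᶻ_x Uᴴ = -Sᶻ_x`. [cite: KomaTasaki1993, §2 (2.5)] -/
theorem halfTurnY_conj_siteSpin_two (x : Λ) :
    halfTurnY n * siteSpin n x 2 * (halfTurnY n)ᴴ = -(siteSpin n x 2 : Op Λ (n + 1)) := by
  rw [halfTurnY_conj, quarterTurnY_conj_siteSpin_two, quarterTurnY_conj_siteSpin_zero]

/-- `U Sˣ_x Uᴴ = -Sˣ_x`. [cite: KomaTasaki1993, §2 (2.5)] -/
theorem halfTurnY_conj_siteSpin_zero (x : Λ) :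
    halfTurnY n * siteSpin n x 0 * (halfTurnY n)ᴴ = -(siteSpin n x 0 : Op Λ (n + 1)) := by
  rw [halfTurnY_conj, quarterTurnY_conj_siteSpin_zero, Matrix.mul_neg, Matrix.neg_mul, quarterTurnY_conj_siteSpin_two]

/-- `U Sʸ_x Uᴴ = Sʸ_x`. [cite: KomaTasaki1993, §2 (2.3)] -/
theorem halfTurnY_conj_siteSpin_one (x : Λ) :
    halfTurnY n * siteSpin n x 1 * (halfTurnY n)ᴴ = (siteSpin n x 1 : Op Λ (n + 1)) := by
  rw [halfTurnY_conj, quarterTurnY_conj_siteSpin_one, quarterTurnY_conj_siteSpin_one]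

/-- The half turn fixes the bond `Bˣ_{xy}` (`(-Sˣ_x)(-Sˣ_y) = Sˣ_xSˣ_y`). [cite: KomaTasaki1993, §2 (2.3)] -/
theorem halfTurnY_conj_spinBond_zero (x y : Λ) :
    halfTurnY n * spinBond n 0 x y * (halfTurnY n)ᴴ = (spinBond n 0 x y : Op Λ (n + 1)) := by
  rw [spinBond, Matrix.mul_smul, Matrix.smul_mul, Matrix.mul_add, Matrix.add_mul,
    conj_mul_of_conjTranspose_mul (halfTurnY_conjTranspose_mul n),
    conj_mul_of_conjTranspose_mul (halfTurnY_conjTranspose_mul n), halfTurnY_conj_siteSpin_zero,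
    halfTurnY_conj_siteSpin_zero, neg_mul_neg, neg_mul_neg]

/-- The half turn fixes the bond `Bʸ_{xy}`. [cite: KomaTasaki1993, §2 (2.3)] -/
theorem halfTurnY_conj_spinBond_one (x y : Λ) :
    halfTurnY n * spinBond n 1 x y * (halfTurnY n)ᴴ = (spinBond n 1 x y : Op Λ (n + 1)) := by
  rw [spinBond, Matrix.mul_smul, Matrix.smul_mul, Matrix.mul_add, Matrix.add_mul,
    conj_mul_of_conjTranspose_mul (halfTurnY_conjTranspose_mul n),
    conj_mul_of_conjTranspose_mul (halfTurnY_conjTranspose_mul n), halfTurnY_conj_siteSpin_one,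
    halfTurnY_conj_siteSpin_one]

/-- The half turn fixes the bond `Bᶻ_{xy}` (`(-Sᶻ_x)(-Sᶻ_y) = Sᶻ_xSᶻ_y`). [cite: KomaTasaki1993, §2 (2.3)] -/
theorem halfTurnY_conj_spinBond_two (x y : Λ) :
    halfTurnY n * spinBond n 2 x y * (halfTurnY n)ᴴ = (spinBond n 2 x y : Op Λ (n + 1)) := by
  rw [spinBond, Matrix.mul_smul, Matrix.smul_mul, Matrix.mul_add, Matrix.add_mul,
    conj_mul_of_conjTranspose_mul (halfTurnY_conjTranspose_mul n),
    conj_mul_of_conjTranspose_mul (halfTurnY_conjTranspose_mul n), halfTurnY_conj_siteSpin_two,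
    halfTurnY_conj_siteSpin_two, neg_mul_neg, neg_mul_neg]

/-- The half turn fixes the XXZ bond. [cite: KomaTasaki1993, §2 (2.3)] [cite: Tasaki2020, §2.4] -/
theorem halfTurnY_conj_bond (Δ : ℝ) (x y : Λ) :
    halfTurnY n * bond n Δ x y * (halfTurnY n)ᴴ = bond n Δ x y := by
  unfold bond
  rw [Matrix.mul_add, Matrix.add_mul, Matrix.mul_add, Matrix.add_mul, Matrix.mul_smul, Matrix.smul_mul,
    halfTurnY_conj_spinBond_zero, halfTurnY_conj_spinBond_one, halfTurnY_conj_spinBond_two]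

/-- **`U H_XXZ Uᴴ = H_XXZ` for every `J, Δ`** (KT93 (2.3) for the half turn about the `2`-axis).
[cite: KomaTasaki1993, §2 (2.3)] [cite: Tasaki2020, §2.4] -/
theorem halfTurnY_conj_xxzHamiltonian (G : SimpleGraph Λ) [DecidableRel G.Adj] (J Δ : ℝ) :
    halfTurnY n * xxzHamiltonian n G J Δ * (halfTurnY n)ᴴ = xxzHamiltonian n G J Δ := by
  rw [xxzHamiltonian_eq_sum_bond, Matrix.mul_smul, Matrix.smul_mul, Finset.mul_sum, Finset.sum_mul]
  congr 1
  refine Finset.sum_congr rfl fun e _ => ?_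
  induction e using Sym2.ind with
  | h x y =>
    simp only [Sym2.lift_mk]
    exact halfTurnY_conj_bond n Δ x y

variable (σ : Λ → ℕ)

/-- The half turn about the `2`-axis flips `O^{(3)} = Σ(-1)^xSᶻ_x` (KT93 (2.5)). [cite: KomaTasaki1993, §2 (2.5)] -/
theorem halfTurnY_conj_stagSpin_two :
    halfTurnY n * stagSpin n σ 2 * (halfTurnY n)ᴴ = -(stagSpin n σ 2 : Op Λ (n + 1)) := by
  rw [stagSpin, Finset.mul_sum, Finset.sum_mul, ← Finset.sum_neg_distrib]
  refine Finset.sum_congr rfl fun x _ => ?_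
  rw [Matrix.mul_smul, Matrix.smul_mul, halfTurnY_conj_siteSpin_two, smul_neg]

end Graph

/-! ### §2. The torus: the Ising-side antiferromagnetic `ℤ₂` system -/

section Torus

variable (d L n : ℕ) [NeZero L]

/-- **THE XXZ ANTIFERROMAGNET ON THE TORUS AS A KOMA–TASAKI `ℤ₂` SYSTEM WITH NÉEL ORDER** (KT93 §1, §2):
`h_x` the halved XXZ bonds out of `x`, `o_x = (-1)^xSᶻ_x` (`O_Λ = Σ_x(-1)^xSᶻ_x`), `U_Λ` the half turn about the
`2`-axis, `S(x)` the closed neighbourhood (`r = 2d+2`), `h̄ = hbar`, `ō = s`.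
[cite: KomaTasaki1993, §1 (1.1)–(1.2), §2 (2.1)–(2.9), ii), iii)] [cite: DLS1978, §1] -/
def isingAFZ2System (J Δ : ℝ) :
    KomaTasaki.Z2System (Fintype.card (TorusSite d L)) (hbar d n J Δ) (sNorm n) (2 * d + 2)
      (TorusSite d L → Fin (n + 1)) where
  h i := localHam n (torusGraph d L) J Δ ((Fintype.equivFin (TorusSite d L)).symm i)
  o i := (stagSign (torusParityExp d L) ((Fintype.equivFin (TorusSite d L)).symm i) : ℂ) •
    siteSpin n ((Fintype.equivFin (TorusSite d L)).symm i) 2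
  U := halfTurnY n
  supp i := (nbhd d L ((Fintype.equivFin (TorusSite d L)).symm i)).map (Fintype.equivFin (TorusSite d L)).toEmbedding
  isHermitian_h i := isHermitian_localHam n _ J Δ _
  isHermitian_o i := isHermitian_stagSign_smul_siteSpin n _ _ 2
  U_mul_conjTranspose := halfTurnY_mul_conjTranspose n
  conj_hamiltonian := by
    rw [(Fintype.equivFin (TorusSite d L)).symm.sum_comp (fun y => localHam n (torusGraph d L) J Δ y), sum_localHam,
      halfTurnY_conj_xxzHamiltonian]
  conj_order := by
    rw [sum_equivFin_stagSign_smul_siteSpin]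
    exact halfTurnY_conj_stagSpin_two n (torusParityExp d L)
  norm_h_le i := norm_localHam_le d L n J Δ _
  norm_o_le i := norm_stagSign_smul_siteSpin_le n _ _ 2
  commute_h_o i j hj := by
    have hj' : (Fintype.equivFin (TorusSite d L)).symm j ∉ nbhd d L ((Fintype.equivFin (TorusSite d L)).symm i) := by
      rwa [Finset.mem_map_equiv] at hj
    have hne : (Fintype.equivFin (TorusSite d L)).symm j ≠ (Fintype.equivFin (TorusSite d L)).symm i := fun h =>
      hj' (h ▸ Finset.mem_insert_self _ _)
    have hadj : ¬ (torusGraph d L).Adj ((Fintype.equivFin (TorusSite d L)).symm i)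
        ((Fintype.equivFin (TorusSite d L)).symm j) := fun h =>
      hj' (Finset.mem_insert_of_mem (Finset.mem_filter.2 ⟨Finset.mem_univ _, h⟩))
    exact commute_localHam_stagSign_smul_siteSpin n _ (torusGraph d L) J Δ hne hadj 2
  card_supp_le i := by
    rw [Finset.card_map]
    exact (card_nbhd_le d L _).trans (by omega)
  two_le_r := by omega

/-! #### Dictionary -/

/-- `H_Λ = xxzHamiltonian n (torusGraph d L) J Δ`. [cite: KomaTasaki1993, §2 (2.2)] -/
theorem isingAFZ2System_hamiltonian (J Δ : ℝ) :
    (isingAFZ2System d L n J Δ).hamiltonian = xxzHamiltonian n (torusGraph d L) J Δ := by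
  rw [KomaTasaki.Z2System.hamiltonian]
  change ∑ i, localHam n (torusGraph d L) J Δ ((Fintype.equivFin (TorusSite d L)).symm i) = _
  rw [(Fintype.equivFin (TorusSite d L)).symm.sum_comp (fun y => localHam n (torusGraph d L) J Δ y), sum_localHam]

/-- `O_Λ = Σ_x(-1)^xSᶻ_x`. [cite: KomaTasaki1993, §1 (1.2), §2 (2.4)] -/
theorem isingAFZ2System_order (J Δ : ℝ) :
    (isingAFZ2System d L n J Δ).order = (stagSpin n (torusParityExp d L) 2 : Op (TorusSite d L) (n + 1)) := by
  rw [KomaTasaki.Z2System.order]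
  change ∑ i, ((stagSign (torusParityExp d L) ((Fintype.equivFin (TorusSite d L)).symm i) : ℂ) •
    siteSpin n ((Fintype.equivFin (TorusSite d L)).symm i) 2 : Op (TorusSite d L) (n + 1)) = _
  rw [sum_equivFin_stagSign_smul_siteSpin]

/-- `m_Λ(B) = |Λ|⁻¹ Re⟨O_Λ⟩_{β, H - B·O_Λ}` (staggered magnetisation under the staggered field, (1.4)).
[cite: KomaTasaki1993, §1 (1.3)–(1.4), §2 (2.9)] -/
theorem isingAFZ2System_magnetisation (J Δ β B : ℝ) :
    (isingAFZ2System d L n J Δ).magnetisation β B =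
      (Fintype.card (TorusSite d L) : ℝ)⁻¹ *
        (gibbsState β (xxzHamiltonian n (torusGraph d L) J Δ - (B : ℂ) • stagSpin n (torusParityExp d L) 2)
          (stagSpin n (torusParityExp d L) 2)).re := by
  rw [KomaTasaki.Z2System.magnetisation, KomaTasaki.Z2System.fieldHamiltonian, isingAFZ2System_hamiltonian,
    isingAFZ2System_order]

/-- `|Λ| = L^d`. [folklore] -/
private theorem card_torusSite'' : Fintype.card (TorusSite d L) = L ^ d := by
  rw [Fintype.card_pi, prod_const, ZMod.card, card_univ, Fintype.card_fin]

/-- **`N⁻²⟨O_Λ²⟩_Λ(0) = |Λ|⁻² Σ_{x,y} (-1)^x(-1)^y Re⟨Sᶻ_xSᶻ_y⟩_β`** — the Néel long-range order quantity (1.7)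
of `gibbsXXZCorrTorus 2`. [cite: KomaTasaki1993, §1 (1.7), §2 (2.12)] -/
theorem isingAFZ2System_moment_one (J Δ β : ℝ) :
    (isingAFZ2System d L n J Δ).moment β 1 =
      (∑ x : TorusSite d L, ∑ y : TorusSite d L,
          (-1 : ℝ) ^ (∑ i, (x i).val) * (-1) ^ (∑ i, (y i).val) * gibbsXXZCorrTorus 2 (d := d) β L n J Δ x y) /
        (Fintype.card (TorusSite d L) : ℝ) ^ 2 := by
  rw [KomaTasaki.Z2System.moment, isingAFZ2System_hamiltonian, isingAFZ2System_order, mul_one, div_eq_inv_mul]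
  congr 1
  simp only [stagSpin, stagSign, torusParityExp]
  rw [pow_two, Finset.sum_mul_sum, map_sum, Complex.re_sum]
  refine Finset.sum_congr rfl fun x _ => ?_
  rw [map_sum, Complex.re_sum]
  refine Finset.sum_congr rfl fun y _ => ?_
  rw [Matrix.smul_mul, Matrix.mul_smul, smul_smul, LinearMap.map_smul, smul_eq_mul, ← Complex.ofReal_mul,
    Complex.re_ofReal_mul, gibbsXXZCorrTorus_of_neZero]

end Torus

/-! ### §3. Spontaneous Néel magnetisation at `T > 0`, `d ≥ 3`, Ising side -/

section Thermal

variable {d : ℕ}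

/-- From `HasStaggeredEvenTorusLRO` of `gibbsXXZCorrTorus 2` to an eventual floor `σ² ≤ N⁻²⟨O_Λ²⟩_Λ(0)` on all
large even tori, some `σ > 0`. [cite: KomaTasaki1993, §1 (1.7), §2 (2.12)] [cite: DLS1978, §1] -/
theorem exists_sq_le_isingMoment_of_hasStaggeredEvenTorusLRO {n : ℕ} {J Δ β : ℝ}
    (h : HasStaggeredEvenTorusLRO (fun L x y => gibbsXXZCorrTorus 2 (d := d) β L n J Δ x y)) :
    ∃ σ : ℝ, 0 < σ ∧ ∀ᶠ k : ℕ in atTop, σ ^ 2 ≤ (isingAFZ2System d (2 * k + 2) n J Δ).moment β 1 := by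
  rw [hasStaggeredEvenTorusLRO_iff_holds] at h
  obtain ⟨f, hf, hpos⟩ : ∃ f : ℕ → ℝ, (∀ k, f k =
      (∑ x : TorusSite d (2 * k + 2), ∑ y : TorusSite d (2 * k + 2),
          (-1 : ℝ) ^ (∑ i, (x i).val) * (-1) ^ (∑ i, (y i).val) *
            gibbsXXZCorrTorus 2 (d := d) β (2 * k + 2) n J Δ x y) / ((2 * k + 2 : ℕ) : ℝ) ^ (2 * d)) ∧
      0 < liminf f atTop := ⟨_, fun _ => rfl, h⟩
  have hmom : ∀ k : ℕ, f k = (isingAFZ2System d (2 * k + 2) n J Δ).moment β 1 := fun k => by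
    rw [hf, isingAFZ2System_moment_one, card_torusSite'', Nat.cast_pow, ← pow_mul, mul_comm d 2]
  have hnonneg : ∀ k : ℕ, 0 ≤ f k := fun k => by
    rw [hmom]
    exact KomaTasaki.Z2System.moment_nonneg _ β 1
  have hcl : liminf f atTop / 2 < liminf f atTop := half_lt_self hpos
  have hev := eventually_lt_of_lt_liminf hcl (isBoundedUnder_of ⟨0, fun k => hnonneg k⟩)
  refine ⟨Real.sqrt (liminf f atTop / 2), Real.sqrt_pos.2 (half_pos hpos), hev.mono fun k hk => ?_⟩
  rw [Real.sq_sqrt (half_pos hpos).le, ← hmom]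
  exact hk.le

/-- **ENGINE (XXZ on the even tori, any `J, Δ`, every `β > 0`; plain `ℤ₂`, factor `1`).**  Néel long-range order of
`Sᶻ` in the symmetric Gibbs states forces, for some `σ > 0` and every staggered field `B > 0`, `ε > 0`, eventually
on the even tori: `σ - ε ≤ |Λ|⁻¹ Re⟨O_Λ⟩_{β, H - B·O_Λ}`, `O_Λ = Σ_x(-1)^xSᶻ_x` — KT93 Theorem 2.1 (2.13) with `k = 1`,
hypothesis i) removed (`Z2System.le_magnetisation_add_of_eventually_moment_one`).
[cite: KomaTasaki1993, Theorem 2.1 (2.13), §1 (1.4)–(1.8)] -/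
theorem af_thermal_neelMagnetisation_ge_of_LRO (hd : 1 ≤ d) {n : ℕ} {J Δ β : ℝ} (hβ : 0 < β)
    (h : HasStaggeredEvenTorusLRO (fun L x y => gibbsXXZCorrTorus 2 (d := d) β L n J Δ x y)) :
    ∃ σ : ℝ, 0 < σ ∧ ∀ B : ℝ, 0 < B → ∀ ε : ℝ, 0 < ε → ∀ᶠ k : ℕ in atTop,
      σ - ε ≤ (Fintype.card (TorusSite d (2 * k + 2)) : ℝ)⁻¹ *
        (gibbsState β (xxzHamiltonian n (torusGraph d (2 * k + 2)) J Δ -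
            (B : ℂ) • stagSpin n (torusParityExp d (2 * k + 2)) 2)
          (stagSpin n (torusParityExp d (2 * k + 2)) 2)).re := by
  obtain ⟨σ, hσ, hLRO⟩ := exists_sq_le_isingMoment_of_hasStaggeredEvenTorusLRO h
  refine ⟨σ, hσ, fun B hB ε hε => ?_⟩
  have hev := KomaTasaki.Z2System.le_magnetisation_add_of_eventually_moment_one
    (fun k => isingAFZ2System d (2 * k + 2) n J Δ) (zero_le_one.trans (one_le_sNorm n)) hβ
    (tendsto_card_torusSite_two_mul_add_two hd) (fun k => log_card_config_le d (2 * k + 2) n) hσ.le hLRO hB hε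
  filter_upwards [hev] with k hk
  rw [isingAFZ2System_magnetisation] at hk
  linarith

/-- **NÉEL ORDER ⟹ SPONTANEOUS STAGGERED MAGNETISATION FOR THE XXZ ANTIFERROMAGNET ON THE ISING SIDE AT `T > 0`,
`d ≥ 3` (KT93 Theorem 2.1 BY NAME — the order operator does NOT commute with the Hamiltonian —, hypothesis i)
removed).**  For `d ≥ 3`, every spin `S = n/2 ≥ ½`, `J > 0` and `Δ ≥ 1` there is `β₀ > 0` such that for every
`β ≥ β₀` there is `σ > 0` (Dyson–Lieb–Simon's Néel long-range order at `β`, here Björnberg–Ueltschi for every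
spin) with: for every staggered field `B > 0` and every `ε > 0`, eventually on the even tori `(ℤ/(2k+2)ℤ)^d`,
**`σ - ε ≤ |Λ|⁻¹ Re⟨O_Λ⟩_{β, H - B·O_Λ}`**, `H = xxzHamiltonian n (torusGraph d (2k+2)) J Δ = J Σ(SˣSˣ + SʸSʸ + ΔSᶻSᶻ)`,
`O_Λ = Σ_x(-1)^xSᶻ_x`; hence `m_s ≥ σ > 0` (1.5)–(1.6) along every convergent choice of the limits.
[cite: KomaTasaki1993, Theorem 2.1 (2.13), §1 (1.1)–(1.8)] [cite: DLS1978, §1–§2, Theorem 1.2]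
[cite: BjornbergUeltschi2022, Theorem 3.2] -/
theorem xxzAF_thermal_spontaneousNeelMagnetisation (hd : 3 ≤ d) {n : ℕ} (hn : 1 ≤ n) {J : ℝ} (hJ : 0 < J)
    {Δ : ℝ} (hΔ : 1 ≤ Δ) :
    ∃ β₀ : ℝ, 0 < β₀ ∧ ∀ β : ℝ, β₀ ≤ β → ∃ σ : ℝ, 0 < σ ∧ ∀ B : ℝ, 0 < B → ∀ ε : ℝ, 0 < ε →
      ∀ᶠ k : ℕ in atTop,
        σ - ε ≤ (Fintype.card (TorusSite d (2 * k + 2)) : ℝ)⁻¹ *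
          (gibbsState β (xxzHamiltonian n (torusGraph d (2 * k + 2)) J Δ -
              (B : ℂ) • stagSpin n (torusParityExp d (2 * k + 2)) 2)
            (stagSpin n (torusParityExp d (2 * k + 2)) 2)).re := by
  obtain ⟨β₀, hβ₀, hlro⟩ := xxzAF_thermal_neel hd hn hJ hΔ
  exact ⟨β₀, hβ₀, fun β hβ =>
    af_thermal_neelMagnetisation_ge_of_LRO (by omega) (lt_of_lt_of_le hβ₀ hβ) (hlro β hβ)⟩

end Thermal

end XXZKT

end Literature.MathematicalPhysics.QuantumLattice
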